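/-
Copyright (c) 2026. All rights reserved.
Released under Apache 2.0 license as described in the file LICENSE.
Authors: abc-iut cell, prover seat abc-iut-w6-d031 (gen 5; PROOF-ONLY: hypothesis (P) of the
[AbsTopIII] Prop 4.2 (i) geometric column at EVERY genuine punctured Riemann surface `M ∖ S`, in
particular at the once-punctured elliptic curve `E ∖ {x₀}`).
-/
import Literature.AnabelianGeometry.AbsoluteAnabelian.ArchimedeanHolFieldFunctorGeometricPSLCuspParabolic
import Literature.AnabelianGeometry.AbsoluteAnabelian.ArchimedeanHolFieldFunctorGeometricOverIdRigidTorus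
import HarnessLib

/-!
# A puncture of a Riemann surface is a cusp of every uniformising group: hypothesis (P)

S. Mochizuki, *Topics in Absolute Anabelian Geometry III*, proof of Prop. 4.2 (i) (p. 106), at the
uniformised model `X = ℍ/Λ̄`; classical input (H. M. Farkas, I. Kra, *Riemann Surfaces* (1992),
IV.5.5–IV.5.6, IV.6): a PUNCTURE of `X` — a point `x₀ ∉ X` of an ambient Riemann surface `M` with a
punctured neighbourhood inside `X` — is a CUSP of `Λ̄`.  This PROOF-ONLY file (no definitions, no named
facts) builds the holomorphic END at `x₀` from the chart of `M` at `x₀` — `τ ↦ (chart at x₀)⁻¹ (c₀ +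
(r/2) e^{2πiτ})` — and feeds it to abc-iut-w6-d031's `HolRS.exists_parabolic_mem_of_end`:

* `HolRS.exists_end_ofOpens_puncture` — the end at a puncture `x₀` of `X = HolRS.ofOpens U hU`
  (`U ⊆ M` open connected, `x₀ ∉ U`, some punctured neighbourhood of `x₀` inside `U`);
* ★ `HolRS.exists_parabolic_mem_of_cover_ofOpens_puncture` — for EVERY holomorphic covering
  `k : ℍ → X` whose Möbius deck group `Λ̄` (membership criterion) acts freely, `Λ̄ ∋ π(t)` with
  `t ∈ SL(2, ℝ)` PARABOLIC — hypothesis (P) of abc-iut-L4-d1's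
  `HolRS.finiteIndex_subgroupOf_normalizer_of_cusps`, binder shape verbatim;
* ★ `HolRS.exists_parabolic_mem_of_cover_puncturedTorus` — the case `E ∖ {x₀}`
  (abc-iut-L4-t12's `HolRS.puncturedTorus Φ x₀`, the hyperbolic curve of type `(1,1)`), for every
  uniformising `k`; `HolRS.exists_parabolic_mem_of_cover_ofOpens_compl_finite` — `M ∖ S`, `S` finite.

MODEL side of [AbsTopIII] §4; the companion hypothesis (FC) for the abstract deck group is NOT proved
here; nothing here bears on [IUTchIII] Cor. 3.12.

## References

* S. Mochizuki, *Topics in Absolute Anabelian Geometry III* (2015), proof of Prop. 4.2 (i) p.106,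
  Def. 4.1 (i) p.101. [MochizukiAbsTopIII2015]
* H. M. Farkas, I. Kra, *Riemann Surfaces*, 2nd ed. (1992), IV.5.5–IV.5.6. [FarkasKra1992]
-/

set_option autoImplicit false

noncomputable section

open Complex Filter Topology Metric Set Function
open scoped UpperHalfPlane MatrixGroups Manifold ContDiff Real
open UpperHalfPlane (upperHalfPlaneSet isOpen_upperHalfPlaneSet)
open Literature.Analysis.Complex.TranslationEquivariant
open _root_.TopologicalSpace (Opens)
open Literature.Geometry.Kaehler (ComplexTorus)

namespace Literature.AnabelianGeometry.AbsoluteAnabelian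

namespace HolRS

section Puncture

variable {M : Type} [TopologicalSpace M] [T2Space M] [ChartedSpace ℂ M] [IsManifold 𝓘(ℂ, ℂ) ω M]

/-- The filter «`Im τ → ∞`» on `ℍ` is non-trivial. [folklore] -/
private theorem neBot_comap_im' : (comap UpperHalfPlane.im atTop).NeBot := by
  refine atTop_neBot.comap_of_range_mem (mem_atTop_sets.mpr ⟨1, fun b hb => ?_⟩)
  have hb0 : 0 < b := lt_of_lt_of_le one_pos hb
  refine ⟨UpperHalfPlane.mk ((b : ℂ) * I) (by simpa using hb0), ?_⟩
  simp

/-- The model end `g w = c₀ + (r/2) e^{2πiw}`: holomorphic, at distance `(r/2) e^{-2π Im w}` from `c₀`.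
[folklore] -/
private theorem norm_modelEnd_sub (c₀ : ℂ) {r : ℝ} (hr : 0 < r) (w : ℂ) :
    ‖(c₀ + ((r / 2 : ℝ) : ℂ) * exp (2 * π * I * w)) - c₀‖ = r / 2 * Real.exp (-2 * π * w.im) := by
  simp only [add_sub_cancel_left, norm_mul, Complex.norm_real, Real.norm_eq_abs,
    abs_of_pos (half_pos hr), norm_exp_two_pi_I_mul]

/-- **The end of `X = U ⊆ M` at a puncture `x₀`.**  If `x₀ ∉ U` has a punctured neighbourhood inside
the connected open `U ⊆ M`, there is a holomorphic `e : ℍ → X`, `1`-periodic, converging to no point of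
`X` as `Im τ → ∞` (in `M` it converges to `x₀`): `e τ = (chart at x₀)⁻¹ (c₀ + (r/2) e^{2πiτ})`.
[cite: FarkasKra1992, IV.5.5–IV.5.6] [cite: MochizukiAbsTopIII2015, Definition 4.1 (i) p.101] -/
theorem exists_end_ofOpens_puncture (U : Opens M) (hU : IsConnected (U : Set M)) {x₀ : M}
    (hx₀ : x₀ ∉ (U : Set M)) (hpunct : ∃ V ∈ 𝓝 x₀, V \ {x₀} ⊆ (U : Set M)) :
    ∃ e : ℍ → (ofOpens U hU).carrier,
      MDifferentiable 𝓘(ℂ, ℂ) 𝓘(ℂ, ℂ) e ∧ (∀ τ τ' : ℍ, (τ' : ℂ) = τ + 1 → e τ' = e τ) ∧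
      ∀ x : (ofOpens U hU).carrier, ¬ Tendsto e (comap UpperHalfPlane.im atTop) (𝓝 x) := by
  obtain ⟨V, hV, hVU⟩ := hpunct
  -- the chart at `x₀` and a small ball in its target
  set φ := extChartAt 𝓘(ℂ, ℂ) x₀ with hφ
  set c₀ : ℂ := φ x₀ with hc₀
  have hc₀t : c₀ ∈ φ.target := mem_extChartAt_target x₀
  have htarget : IsOpen φ.target := isOpen_extChartAt_target x₀
  have hsymm_cont : ContinuousAt φ.symm c₀ := continuousAt_extChartAt_symm x₀
  have hsymm_c₀ : φ.symm c₀ = x₀ := extChartAt_to_inv x₀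
  -- `ρ`: ball in the target whose image under `φ.symm` lies in `V`
  have hpre : φ.symm ⁻¹' V ∈ 𝓝 c₀ := hsymm_cont (by rw [hsymm_c₀]; exact hV)
  obtain ⟨r, hr, hball⟩ := Metric.mem_nhds_iff.mp (inter_mem (htarget.mem_nhds hc₀t) hpre)
  -- the model end and the end
  let g : ℂ → ℂ := fun w => c₀ + ((r / 2 : ℝ) : ℂ) * exp (2 * π * I * w)
  have hg_diff : Differentiable ℂ g := by
    refine (differentiable_const _).add ((differentiable_const _).mul ?_)
    exact differentiable_exp.comp ((differentiable_const _).mul differentiable_id)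
  have hg_ball : ∀ τ : ℍ, g τ ∈ ball c₀ r := fun τ => by
    rw [mem_ball, dist_eq_norm, norm_modelEnd_sub c₀ hr]
    have : Real.exp (-2 * π * (τ : ℂ).im) < 1 := by
      rw [← Real.exp_zero, Real.exp_lt_exp]
      have := τ.im_pos
      rw [← UpperHalfPlane.coe_im] at this
      nlinarith [Real.pi_pos]
    nlinarith
  have hg_ne : ∀ τ : ℍ, g τ ≠ c₀ := fun τ h => by
    have h0 : ‖g τ - c₀‖ = 0 := by rw [h, sub_self, norm_zero]
    rw [norm_modelEnd_sub c₀ hr] at h0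
    have := Real.exp_pos (-2 * π * (τ : ℂ).im)
    nlinarith
  have hg_t : ∀ τ : ℍ, g τ ∈ φ.target := fun τ => (hball (hg_ball τ)).1
  have hg_V : ∀ τ : ℍ, φ.symm (g τ) ∈ V := fun τ => (hball (hg_ball τ)).2
  have hg_x₀ : ∀ τ : ℍ, φ.symm (g τ) ≠ x₀ := fun τ h => by
    apply hg_ne τ
    have h' : φ.symm (g τ) = φ.symm c₀ := by rw [h, hsymm_c₀]
    exact φ.symm.injOn (hg_t τ) hc₀t h'
  have hmem : ∀ τ : ℍ, φ.symm (g τ) ∈ (U : Set M) := fun τ => hVU ⟨hg_V τ, hg_x₀ τ⟩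
  let e : ℍ → (ofOpens U hU).carrier := fun τ => ⟨φ.symm (g τ), hmem τ⟩
  have he_val : ∀ τ : ℍ, (e τ).1 = φ.symm (g τ) := fun τ => rfl
  -- holomorphy of the `ℂ`-valued model end on `ℍ`
  have hg_md : MDifferentiable 𝓘(ℂ, ℂ) 𝓘(ℂ, ℂ) (fun τ : ℍ => g τ) := fun τ => by
    rw [UpperHalfPlane.mdifferentiableAt_iff]
    have h3 : (fun z : ℂ => g (UpperHalfPlane.ofComplex z)) =ᶠ[𝓝 (τ : ℂ)] g := by
      filter_upwards [isOpen_upperHalfPlaneSet.mem_nhds τ.im_pos] with z hz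
      have hz : 0 < z.im := hz
      rw [UpperHalfPlane.ofComplex_apply_of_im_pos hz, UpperHalfPlane.coe_mk]
    exact ((hg_diff _).congr_of_eventuallyEq h3 :)
  refine ⟨e, fun τ => ?_, fun τ τ' h => ?_, fun x hx => ?_⟩
  · -- holomorphy: `Subtype.val ∘ e = φ.symm ∘ g ∘ coe`
    have h1 : MDifferentiableAt 𝓘(ℂ, ℂ) 𝓘(ℂ, ℂ) (Subtype.val ∘ e) τ ↔
        MDifferentiableAt 𝓘(ℂ, ℂ) 𝓘(ℂ, ℂ) e τ :=
      ChartedSpace.liftPropWithinAt_subtypeVal_comp_iff ..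
    rw [← h1]
    have h2 : (Subtype.val ∘ e) = (fun c => φ.symm c) ∘ (fun τ : ℍ => g τ) := funext fun τ => rfl
    rw [h2]
    have hsymm_md : MDifferentiableAt 𝓘(ℂ, ℂ) 𝓘(ℂ, ℂ) (fun c => φ.symm c) (g τ) :=
      ((contMDiffOn_extChartAt_symm (I := 𝓘(ℂ, ℂ)) (n := ω) x₀).mdifferentiableOn (by simp) _
        (hg_t τ)).mdifferentiableAt (htarget.mem_nhds (hg_t τ))
    exact hsymm_md.comp τ (hg_md τ)
  · -- `1`-periodicity
    apply Subtype.ext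
    rw [he_val, he_val]
    show φ.symm (c₀ + ((r / 2 : ℝ) : ℂ) * exp (2 * π * I * τ')) =
      φ.symm (c₀ + ((r / 2 : ℝ) : ℂ) * exp (2 * π * I * τ))
    rw [h, mul_add, mul_one, Complex.exp_add, Complex.exp_two_pi_mul_I, mul_one]
  · -- no limit in `X`: in `M` the end converges to the puncture `x₀ ∉ U`
    haveI := neBot_comap_im'
    have hval : Tendsto (fun τ => (e τ).1) (comap UpperHalfPlane.im atTop) (𝓝 x.1) :=
      (continuous_subtype_val.tendsto _).comp hx
    have hg_lim : Tendsto (fun τ : ℍ => g τ) (comap UpperHalfPlane.im atTop) (𝓝 c₀) := by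
      rw [tendsto_iff_norm_sub_tendsto_zero]
      have him : Tendsto (fun τ : ℍ => 2 * π * τ.im) (comap UpperHalfPlane.im atTop) atTop :=
        tendsto_comap.const_mul_atTop (by positivity)
      have hexp : Tendsto (fun τ : ℍ => r / 2 * Real.exp (-(2 * π * τ.im)))
          (comap UpperHalfPlane.im atTop) (𝓝 (r / 2 * 0)) :=
        (Real.tendsto_exp_neg_atTop_nhds_zero.comp him).const_mul _
      rw [mul_zero] at hexp
      refine hexp.congr fun τ => ?_
      rw [norm_modelEnd_sub c₀ hr, UpperHalfPlane.coe_im]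
      ring_nf
    have hx₀_lim : Tendsto (fun τ => (e τ).1) (comap UpperHalfPlane.im atTop) (𝓝 x₀) := by
      have := (hsymm_c₀ ▸ hsymm_cont.tendsto).comp hg_lim
      exact this
    have hxx : x.1 = x₀ := tendsto_nhds_unique hval hx₀_lim
    exact hx₀ (hxx ▸ x.2)

/-- ★ **A puncture is a cusp of every uniformising group — hypothesis (P).**  Let `U ⊆ M` be a connected
open subset of a Riemann surface with a puncture `x₀` (`x₀ ∉ U`, a punctured neighbourhood of `x₀` lies
in `U`).  For EVERY holomorphic covering `k : ℍ → X = U` whose Möbius deck group `Λ̄` (membership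
criterion `k (q • τ) = k τ`) acts freely, there is a PARABOLIC `t ∈ SL(2, ℝ)` with `π(t) ∈ Λ̄` — the
binder (P) of `HolRS.finiteIndex_subgroupOf_normalizer_of_cusps`, for the abstract deck group.
[cite: FarkasKra1992, IV.5.5–IV.5.6] [cite: MochizukiAbsTopIII2015, Proposition 4.2 (i) proof p.106] -/
theorem exists_parabolic_mem_of_cover_ofOpens_puncture (U : Opens M) (hU : IsConnected (U : Set M))
    {x₀ : M} (hx₀ : x₀ ∉ (U : Set M)) (hpunct : ∃ V ∈ 𝓝 x₀, V \ {x₀} ⊆ (U : Set M))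
    {k : ℍ → (ofOpens U hU).carrier} (hk : IsCoveringMap k) (dk : MDifferentiable 𝓘(ℂ, ℂ) 𝓘(ℂ, ℂ) k)
    (Λ : Subgroup PSL2R) [IsCancelSMul Λ ℍ] (hΛ : ∀ q : PSL2R, q ∈ Λ ↔ ∀ τ : ℍ, k (q • τ) = k τ) :
    ∃ t : SL(2, ℝ), (QuotientGroup.mk' (Subgroup.center SL(2, ℝ)) t : PSL2R) ∈ Λ ∧
      (t : Matrix (Fin 2) (Fin 2) ℝ).IsParabolic := by
  obtain ⟨e, de, hper, hend⟩ := exists_end_ofOpens_puncture U hU hx₀ hpunct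
  exact exists_parabolic_mem_of_end _ hk dk Λ hΛ de hper hend

/-- **`M ∖ S` for `S` finite non-empty**: every uniformising Möbius deck group of the connected Riemann
surface `M ∖ S` contains a parabolic element (the punctures are isolated, so each `x₀ ∈ S` has a
punctured neighbourhood in `M ∖ S`). [cite: FarkasKra1992, IV.5.5–IV.5.6]
[cite: MochizukiAbsTopIII2015, Proposition 4.2 (i) proof p.106] -/
theorem exists_parabolic_mem_of_cover_ofOpens_compl_finite {S : Set M} (hS : S.Finite)
    (hne : S.Nonempty) (hconn : IsConnected (Sᶜ : Set M))
    {k : ℍ → (ofOpens (⟨Sᶜ, hS.isClosed.isOpen_compl⟩ : Opens M) hconn).carrier}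
    (hk : IsCoveringMap k) (dk : MDifferentiable 𝓘(ℂ, ℂ) 𝓘(ℂ, ℂ) k)
    (Λ : Subgroup PSL2R) [IsCancelSMul Λ ℍ] (hΛ : ∀ q : PSL2R, q ∈ Λ ↔ ∀ τ : ℍ, k (q • τ) = k τ) :
    ∃ t : SL(2, ℝ), (QuotientGroup.mk' (Subgroup.center SL(2, ℝ)) t : PSL2R) ∈ Λ ∧
      (t : Matrix (Fin 2) (Fin 2) ℝ).IsParabolic := by
  obtain ⟨x₀, hx₀⟩ := hne
  refine exists_parabolic_mem_of_cover_ofOpens_puncture _ hconn (x₀ := x₀)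
    (fun h => (show x₀ ∈ Sᶜ from h) hx₀)
    ⟨(S \ {x₀})ᶜ, ?_, fun y hy => ?_⟩ hk dk Λ hΛ
  · exact ((hS.subset fun z hz => hz.1).isClosed.isOpen_compl).mem_nhds fun h => h.2 rfl
  · show y ∈ Sᶜ
    intro hyS
    exact hy.1 ⟨hyS, hy.2⟩

end Puncture

/-- ★ **The once-punctured elliptic curve `E ∖ {x₀}`**: for EVERY holomorphic covering
`k : ℍ → E ∖ {x₀}` whose Möbius deck group `Λ̄` acts freely, `Λ̄` contains the image of a PARABOLIC
element of `SL(2, ℝ)` — hypothesis (P) of the geometric [AbsTopIII] Prop 4.2 (i) column at the genuine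
curve of type `(1,1)`. [cite: MochizukiAbsTopIII2015, Proposition 4.2 (i) proof p.106]
[cite: FarkasKra1992, IV.5.5–IV.5.6] -/
theorem exists_parabolic_mem_of_cover_puncturedTorus (Φ : (Fin 2 → ℝ) ≃L[ℝ] ℂ) (x₀ : ComplexTorus Φ)
    {k : ℍ → (puncturedTorus Φ x₀).carrier} (hk : IsCoveringMap k)
    (dk : MDifferentiable 𝓘(ℂ, ℂ) 𝓘(ℂ, ℂ) k) (Λ : Subgroup PSL2R) [IsCancelSMul Λ ℍ]
    (hΛ : ∀ q : PSL2R, q ∈ Λ ↔ ∀ τ : ℍ, k (q • τ) = k τ) :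
    ∃ t : SL(2, ℝ), (QuotientGroup.mk' (Subgroup.center SL(2, ℝ)) t : PSL2R) ∈ Λ ∧
      (t : Matrix (Fin 2) (Fin 2) ℝ).IsParabolic :=
  exists_parabolic_mem_of_cover_ofOpens_puncture (M := ComplexTorus Φ) ⟨{x₀}ᶜ, isOpen_compl_singleton⟩
    (isConnected_compl_singleton_complexTorus Φ x₀) (x₀ := x₀) (fun h => h rfl)
    ⟨univ, univ_mem, fun _ hy => hy.2⟩ hk dk Λ hΛ

end HolRS

end Literature.AnabelianGeometry.AbsoluteAnabelian

end
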